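import Literature.Barriers.CriticalPhenomena.WeaklySAWCriticalNuFlowIteration
import Literature.Barriers.CriticalPhenomena.WeaklySAWGreenZeroDecomposition
import Literature.Barriers.CriticalPhenomena.WeaklySAWPerturbativeBetaBounds
import HarnessLib

/-!
# BBS 2015, §8.5: the decomposition inputs of the proof of Theorem 1.2 are theorems for the explicit
# finite-range decomposition — `C(0) = Σ_lC_{l+1;0,0}`, `C_{l+1;0,0} = O(L^{-2l})`, `(β_j)` bounded

Companion file of `WeaklySAWCriticalNuFlowIteration.lean`, which proves the printed §8.5 ("Proof of
Theorem 1.2") of Bauerschmidt–Brydges–Slade, CMP 337 (2015), arXiv:1403.7422, for ANY data with the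
printed properties, packaged in the hypothesis structure `CTWSAW.MuFlowAt φ G δ' L A B C₁ β`:
Proposition 7.1's flow at `m² = 0` (field `flow`) together with three inputs about the covariance
decomposition at `m² = 0` — "Since `C(0) = Σ_{l=0}^∞ C_{l+1;0,0}`" (`hasSum_C₁`), "`C_{l+1;0,0} =
O(L^{-2l})`" (`abs_C₁_mul_le`) and the boundedness of `(β_j)` (Assumption (A1), `abs_β_le`).

For the EXPLICIT decomposition of [Baue13a]/BBS used by the source — `C_{l+1} = Γ_{l+1}(0) =
LongRangePhi4.FRD.Gam 4 L 0 (l+1)`, `β_j = CTWSAW.betaPT 4 L 0 j` (§6.1) — these three inputs are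
THEOREMS of the tree: `hasSum_Gam_greenZero_four` (`WeaklySAWGreenZeroDecomposition.lean`, with
`C(0) = C₀(0) = greenZero 4`), the scaling estimate `abs_Gam_four_le` and `BBS2015_A1_bounded`
(`WeaklySAWPerturbativeBetaBounds.lean`). This file records them in the shape of `MuFlowAt`'s fields
and provides the constructor **`MuFlowAt.ofExplicitFlow`**: for the explicit decomposition, §8.5's
hypothesis structure — hence `BBS2015_thm41_nu0c` and Theorem 1.2 (`BBS2015_thm12_of_explicitFlow`) —
follows from Theorem 4.1's data and Proposition 7.1's FLOW ALONE (its `V̌`-component recursions with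
the printed bounds), the decomposition inputs being discharged.

## What this file proves (everything; no definition, no named fact)

* `decompositionInputs_four` — for `L ≥ 2`: `Σ_l Γ_{l+1;0,0}(0) = greenZero 4`, `|Γ_{l+1;0,0}(0)|L^{2l} ≤ c`,
  `|β_j(0)| ≤ KL⁴` for all `l, j`;
* **`MuFlowAt.ofExplicitFlow`** — `MuFlowAt φ (greenZero 4) δ' L (max A c) (KL⁴) (l ↦ Γ_{l+1;0,0}(0)) β`
  from the flow data with constant `A`;
* `BBS2015_thm41_nu0c_of_explicitFlow`, **`BBS2015_thm12_of_explicitFlow_of_lemA1`** — §8.5 and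
  Theorem 1.2 from `Thm41Data`, the explicit flow, and Lemma A.1.
-/

noncomputable section

open Set Filter Topology
open Literature.Probability.LatticeModels
open scoped BigOperators

namespace Literature.Barriers.CriticalPhenomena

namespace CTWSAW

open LongRangePhi4 LongRangePhi4.FRD

/-- **The three decomposition inputs of §8.5 for the explicit decomposition** (`d = 4`, `L ≥ 2`, at
`m² = 0`): `C(0) = Σ_{l≥0}C_{l+1;0,0}` with `C(0) = C₀(0) = greenZero 4`; `C_{l+1;0,0} = O(L^{-2l})`
quantitatively, `|C_{l+1;0,0}|L^{2l} ≤ c`; and `(β_j)` bounded, `|β_j| ≤ KL⁴`.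
[cite: BauerschmidtBrydgesSlade2015LogCorr, §8.5 ("Since C(0) = Σ_{l=0}^∞ C_{l+1;0,0}", "C_{l+1;0,0} = O(L^{-2l})") and §6.1, Assumption (A1)] -/
theorem decompositionInputs_four :
    ∃ c K : ℝ, 0 < c ∧ 0 < K ∧ ∀ L : ℝ, 2 ≤ L →
      HasSum (fun l : ℕ => Gam 4 L 0 (l + 1) 0) (greenZero 4) ∧
      (∀ l : ℕ, |Gam 4 L 0 (l + 1) 0| * L ^ (2 * l) ≤ c) ∧
      (∀ j : ℕ, |betaPT 4 L 0 j| ≤ K * L ^ 4) := by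
  obtain ⟨c, hc, hG⟩ := abs_Gam_four_le
  obtain ⟨K, hK, hβ⟩ := BBS2015_A1_bounded
  refine ⟨c, K, hc, hK, fun L hL => ⟨hasSum_Gam_greenZero_four hL, fun l => ?_, fun j => hβ L hL 0 le_rfl j⟩⟩
  have hL0 : (0 : ℝ) < L := by linarith
  have h := hG L hL 0 le_rfl l 0
  have hp : 0 < L ^ (2 * l) := pow_pos hL0 _
  rw [div_eq_mul_inv, ← div_eq_mul_inv, le_div_iff₀ hp] at h
  exact h

/-- **§8.5's hypothesis structure for the explicit decomposition from the flow alone**: given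
Proposition 7.1's flow at `m² = 0` for `g₀ ∈ (0,δ')` — sequences `μ̌, ǧ, e, r` with `μ̌₀ = φ(g₀)`,
`ǧ₀ = g₀`, `μ̌` bounded, `|ǧ_j| ≤ Ag₀`, the recursions
`μ̌_{j+1} = L²μ̌_j(1 - ¼β_jǧ_j) + 2L^{2(j+1)}C_{j+1;0,0}ǧ_j + e_j`, `|e_j| ≤ Ag₀²`,
`ǧ_{j+1} = ǧ_j - β_jǧ_j² + r_j`, `|r_j| ≤ A|ǧ_j|³`, for the EXPLICIT `C_{j+1;0,0} = Γ_{j+1;0,0}(0)` and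
`β_j = betaPT 4 L 0 j` — the structure `MuFlowAt φ (greenZero 4) δ' L (max A c) (KL⁴) C₁ β` holds,
its decomposition fields being theorems (`decompositionInputs_four`).
[cite: BauerschmidtBrydgesSlade2015LogCorr, §8.5 (proof of Theorem 1.2) and Proposition 7.1] -/
theorem MuFlowAt.ofExplicitFlow {φ : ℝ → ℝ} {δ' L A : ℝ} (hδ' : 0 < δ') (hL : 2 ≤ L)
    (hflow : ∀ g₀ ∈ Ioo (0 : ℝ) δ', ∃ (μ gc e r : ℕ → ℝ) (M : ℝ),
      μ 0 = φ g₀ ∧ gc 0 = g₀ ∧ (∀ j, |μ j| ≤ M) ∧ (∀ j, |gc j| ≤ A * g₀) ∧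
      (∀ j, μ (j + 1) = L ^ 2 * μ j * (1 - (1 / 4 : ℝ) * betaPT 4 L 0 j * gc j) +
        2 * L ^ (2 * (j + 1)) * Gam 4 L 0 (j + 1) 0 * gc j + e j) ∧
      (∀ j, |e j| ≤ A * g₀ ^ 2) ∧
      (∀ j, gc (j + 1) = gc j - betaPT 4 L 0 j * gc j ^ 2 + r j) ∧ (∀ j, |r j| ≤ A * |gc j| ^ 3)) :
    ∃ c K : ℝ, 0 < c ∧ 0 < K ∧
      MuFlowAt φ (greenZero 4) δ' L (max A c) (K * L ^ 4) (fun l => Gam 4 L 0 (l + 1) 0)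
        (fun j => betaPT 4 L 0 j) := by
  obtain ⟨c, K, hc, hK, hin⟩ := decompositionInputs_four
  obtain ⟨hsum, hC₁, hβ⟩ := hin L hL
  refine ⟨c, K, hc, hK, ?_⟩
  refine
    { pos := hδ'
      one_lt := by linarith
      hasSum_C₁ := hsum
      abs_C₁_mul_le := fun j => (hC₁ j).trans (le_max_right _ _)
      abs_β_le := hβ
      flow := fun g₀ hg₀ => ?_ }
  obtain ⟨μ, gc, e, r, M, hμ0, hgc0, hμM, hgcA, hrec, he, hgrec, hr⟩ := hflow g₀ hg₀
  have hg0 : 0 ≤ g₀ := hg₀.1.le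
  refine ⟨μ, gc, e, r, M, hμ0, hgc0, hμM, fun j => (hgcA j).trans ?_, hrec,
    fun j => (he j).trans ?_, hgrec, fun j => (hr j).trans ?_⟩
  · exact mul_le_mul_of_nonneg_right (le_max_left _ _) hg0
  · exact mul_le_mul_of_nonneg_right (le_max_left _ _) (sq_nonneg _)
  · exact mul_le_mul_of_nonneg_right (le_max_left _ _) (by positivity)

/-- `BBS2015_thm41_nu0c` (Theorem 4.1 together with the §8.5 asymptotics of `ν₀ᶜ(0,g₀)`) from
Theorem 4.1's data and the explicit flow at `m² = 0` with `μ̌₀ = ν₀ᶜ(0,g₀)`.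
[cite: BauerschmidtBrydgesSlade2015LogCorr, §8.5 (proof of Theorem 1.2)] -/
theorem BBS2015_thm41_nu0c_of_explicitFlow {δ K₀ : ℝ} {ν₀c z₀c : ℝ → ℝ → ℝ} {cfun : ℝ → ℝ}
    (hD : Thm41Data δ K₀ ν₀c z₀c cfun) {δ' L A : ℝ} (hδ' : 0 < δ') (hL : 2 ≤ L)
    (hflow : ∀ g₀ ∈ Ioo (0 : ℝ) δ', ∃ (μ gc e r : ℕ → ℝ) (M : ℝ),
      μ 0 = ν₀c 0 g₀ ∧ gc 0 = g₀ ∧ (∀ j, |μ j| ≤ M) ∧ (∀ j, |gc j| ≤ A * g₀) ∧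
      (∀ j, μ (j + 1) = L ^ 2 * μ j * (1 - (1 / 4 : ℝ) * betaPT 4 L 0 j * gc j) +
        2 * L ^ (2 * (j + 1)) * Gam 4 L 0 (j + 1) 0 * gc j + e j) ∧
      (∀ j, |e j| ≤ A * g₀ ^ 2) ∧
      (∀ j, gc (j + 1) = gc j - betaPT 4 L 0 j * gc j ^ 2 + r j) ∧ (∀ j, |r j| ≤ A * |gc j| ^ 3)) :
    BBS2015_thm41_nu0c := by
  obtain ⟨c, K, -, -, hF⟩ := MuFlowAt.ofExplicitFlow (φ := ν₀c 0) hδ' hL hflow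
  exact BBS2015_thm41_nu0c_of_muFlowAt hD hF

/-- **Theorem 1.2 of BBS 2015 from Theorem 4.1's data, the explicit flow at `m² = 0`, and Lemma A.1**
(the printed "Proof of Theorem 1.2" with its decomposition inputs discharged for the explicit
decomposition). [cite: BauerschmidtBrydgesSlade2015LogCorr, §8.5 (proof of Theorem 1.2)] -/
theorem BBS2015_thm12_of_explicitFlow_of_lemA1 {δ K₀ : ℝ} {ν₀c z₀c : ℝ → ℝ → ℝ} {cfun : ℝ → ℝ}
    (hD : Thm41Data δ K₀ ν₀c z₀c cfun) {δ' L A : ℝ} (hδ' : 0 < δ') (hL : 2 ≤ L)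
    (hflow : ∀ g₀ ∈ Ioo (0 : ℝ) δ', ∃ (μ gc e r : ℕ → ℝ) (M : ℝ),
      μ 0 = ν₀c 0 g₀ ∧ gc 0 = g₀ ∧ (∀ j, |μ j| ≤ M) ∧ (∀ j, |gc j| ≤ A * g₀) ∧
      (∀ j, μ (j + 1) = L ^ 2 * μ j * (1 - (1 / 4 : ℝ) * betaPT 4 L 0 j * gc j) +
        2 * L ^ (2 * (j + 1)) * Gam 4 L 0 (j + 1) 0 * gc j + e j) ∧
      (∀ j, |e j| ≤ A * g₀ ^ 2) ∧
      (∀ j, gc (j + 1) = gc j - betaPT 4 L 0 j * gc j ^ 2 + r j) ∧ (∀ j, |r j| ≤ A * |gc j| ^ 3))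
    (hA1 : BBS2015_lemA1) : BBS2015_thm12 := by
  obtain ⟨c, K, -, -, hF⟩ := MuFlowAt.ofExplicitFlow (φ := ν₀c 0) hδ' hL hflow
  exact BBS2015_thm12_of_muFlowAt_of_lemA1 hD hF hA1

end CTWSAW

end Literature.Barriers.CriticalPhenomena
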